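import Summits.CriticalPhenomena.PercolationContinuityZ3.Theorems.PercNearOneGluingNoHeavyLowerTailSahiCTCRtThreeRowOne
import Summits.CriticalPhenomena.PercolationContinuityZ3.Theorems.PercNearOneGluingNoHeavyLowerTailSahiCTCRtThreeRowZero
import HarnessLib

/-!
# `NoHeavyLowerTail` (crux stmt-CriticalPhenomena-4575), P3 lane: ROW 1 OF `R_3 ∈ ℕ[s]` IN THE SHAPE OF THE OPEN CORE `hLF`

Support file (seat `prim-l12-p3`, gen 51; `--supports stmt-CriticalPhenomena-4575`; `--computational` only through the import of `…RtThreeRowOne`).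
Memo `run/shared/lean/prim/prim-l12/FROM-prim-l12-p3-g51-ROW0-ALL-K-LEAN.md` §5.
* `coeff_ind_add_single_two_Rt_three_nonneg'` : ROW 1 without the hypotheses `∅ ∉ 𝒳, 𝒵` (a family containing `∅` is `2^α`, and then `R_3 = 0`);
* `coeff_Rt_three_nonneg_of_card_dbl_eq_one` : for up-sets and a profile `n` with entries `≤ 2`, exactly ONE doubled point and at least THREE single points, all
  loop-free in both families, `coeff_n R_3(𝒳,𝒵) ≥ 0` — verbatim the `#dbl n = 1` case of `hLF` of `…RtThreeDiagonalBase.coeff_Rt_three_nonneg_of_loopFree'`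
  except the profiles with `≤ 2` single points (support `≤ 3`), which remain.
No new definitions; nothing is asserted about the crux.
-/

noncomputable section

open scoped Classical

namespace Summit.CriticalPhenomena.PercolationContinuityZ3.Theorems.SahiCTCForms

open Finset MvPolynomial SahiCTCGenFun

namespace RtThreeFin3

open SahiCTCGenFun

/-- ROW 1 without the hypotheses `∅ ∉ 𝒳, 𝒵`: a family containing `∅` is `2^α` and then `R_3 = 0`. [this work] -/
theorem coeff_ind_add_single_two_Rt_three_nonneg' {α : Type*} [DecidableEq α] [Fintype α] {F G : Finset (Finset α)}
    (hF : IsUpperSet (F : Set (Finset α))) (hG : IsUpperSet (G : Set (Finset α))) {σ : Finset α} {d : α} (hd : d ∉ σ) (hσ : 3 ≤ #σ)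
    (h1F : ∀ v ∈ σ, ({v} : Finset α) ∉ F) (h1G : ∀ v ∈ σ, ({v} : Finset α) ∉ G) :
    0 ≤ (Rt 3 F G).coeff (ind σ + Finsupp.single d 2) := by
  by_cases h0F : ∅ ∈ F
  · rw [eq_univ_powerset_of_empty_mem hF h0F, RtThreeFin4.Rt_three_univ_powerset_left, coeff_zero]
  by_cases h0G : ∅ ∈ G
  · rw [eq_univ_powerset_of_empty_mem hG h0G, RtThreeFin4.Rt_three_univ_powerset_right, coeff_zero]
  exact coeff_ind_add_single_two_Rt_three_nonneg hF hG hd hσ h0F h0G h1F h1G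

/-- **ROW 1 IN THE SHAPE OF `hLF`** (the `#dbl n = 1` rows of the open core of `coeff_Rt_three_nonneg_of_loopFree'`, for profiles with at least three single
points): entries `≤ 2`, exactly one doubled point, `≥ 3` single points, single points loop-free ⇒ `coeff_n R_3(𝒳,𝒵) ≥ 0`. [this work] -/
theorem coeff_Rt_three_nonneg_of_card_dbl_eq_one {α : Type*} [DecidableEq α] [Fintype α] {F G : Finset (Finset α)}
    (hF : IsUpperSet (F : Set (Finset α))) (hG : IsUpperSet (G : Set (Finset α))) (n : α →₀ ℕ) (hn : ∀ i, n i ≤ 2) (hd : #(dbl n) = 1)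
    (h3 : 3 ≤ #(n.support.filter fun i => n i = 1)) (hl : ∀ u, n u = 1 → ({u} : Finset α) ∉ F ∧ ({u} : Finset α) ∉ G) :
    0 ≤ (Rt 3 F G).coeff n := by
  obtain ⟨d, hdd⟩ := card_eq_one.1 hd
  have hd2 : n d = 2 := by
    have : d ∈ dbl n := by rw [hdd]; exact mem_singleton_self d
    exact (mem_filter.1 this).2
  set σ := n.support.filter fun i => n i = 1 with hσdef
  have hdσ : d ∉ σ := fun h => by have := (mem_filter.1 h).2; omega
  have hnσ : n = ind σ + Finsupp.single d 2 := by
    ext i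
    rw [Finsupp.add_apply, ind_apply, Finsupp.single_apply]
    by_cases hi : i ∈ σ
    · have h1 : n i = 1 := (mem_filter.1 hi).2
      have hne : d ≠ i := fun h => hdσ (h ▸ hi)
      rw [if_pos hi, if_neg hne, h1, add_zero]
    · rw [if_neg hi]
      by_cases hdi : d = i
      · subst hdi; rw [if_pos rfl, hd2, zero_add]
      · rw [if_neg hdi]
        have hni : n i ≠ 1 := fun h => hi (mem_filter.2 ⟨Finsupp.mem_support_iff.2 (by rw [h]; exact one_ne_zero), h⟩)
        have hn2 : n i ≠ 2 := fun h => hdi (by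
          have : i ∈ dbl n := mem_filter.2 ⟨Finsupp.mem_support_iff.2 (by rw [h]; norm_num), h⟩
          rw [hdd] at this; exact (mem_singleton.1 this).symm)
        have := hn i; omega
  rw [hnσ]
  exact coeff_ind_add_single_two_Rt_three_nonneg' hF hG hdσ h3 (fun v hv => (hl v (mem_filter.1 hv).2).1) (fun v hv => (hl v (mem_filter.1 hv).2).2)

end RtThreeFin3

end Summit.CriticalPhenomena.PercolationContinuityZ3.Theorems.SahiCTCForms
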